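import Summits.PneNP.PneNP.Theorems.ChebyshevTracialDesignLevelMarginals
import HarnessLib

/-!
# Cell pnp-psdrank, route `ChebyshevTracialDesign`: the crux is `𝔖ₙ`-invariant — relabelled strategies are strategies
# with the same value

Simultaneous relabelling of cuts and matchings by `π ∈ 𝔖ₙ` (`U ↦ π(U)`, `M ↦ π·M`) preserves Rothvoß's level classes
`Q_c(t)` (`mem_Qset_relabel_iff`, from `cc_perm` of `ChebyshevTracialDesignLevelMarginals`, p425886), hence every
multilevel weight (`levelWeight_relabel`) [cite: Rothvoss2017, §2 (PDF p. 6)]; double sums over (cuts × matchings) are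
invariant under the diagonal relabelling (`sum_sum_relabel`); a psd rectangle precomposed with the relabelling is a psd
rectangle (`isPsdRect_relabel`: the tight pairs are permuted among themselves) with the SAME value against every multilevel
weight (`value_relabel`). So the crux `TracialDecayExp20` (stmt-PneNP-19878) is a statement about `𝔖ₙ`-ORBITS of
strategies; in particular the direct sum over `𝔖ₙ` of the relabelled copies of a strategy of dimension `r` is an
`𝔖ₙ`-equivariant strategy of dimension `r·n!` with the same normalised value (blocks add: `ChebyshevTracialDesignBlockDiagonal`,
p429187) — symmetrisation costs exactly a factor `n!` of dimension, which is why the dimension budget of the crux cannot be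
removed by passing to the (settled) equivariant case (MEMO-6 A5). [cite: BrietDadushPokutta2014, Thm. 6 (§3)]
WHAT THIS IS NOT: no statement about orbits beyond invariance; nothing on psd rank. Supports crux stmt-PneNP-19878.
-/

set_option linter.dupNamespace false -- `Summit.PneNP.PneNP.…`: summit = sub-problem (D-0017)

noncomputable section

namespace Summit.PneNP.PneNP.Theorems.ChebyshevTracialDesignRelabelling

open Finset Matrix Literature.Barriers.PneNP Literature.Combinatorics.Optimization
open Summit.PneNP.PneNP.Theorems.ChebyshevTracialDesignLevelMarginals

variable {n : ℕ}

/-! ### §1 Level classes and multilevel weights are relabelling-invariant -/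

/-- `(π U, π·M) ∈ Q_c(t) ↔ (U, M) ∈ Q_c(t)`. -/
theorem mem_Qset_relabel_iff (π : Equiv.Perm (Fin n)) (t c : ℕ) (U : OddSet n) (M : PMatch n) :
    ((⟨U.1.image π, odd_card_image π U⟩ : OddSet n), π • M) ∈ Qset n t c ↔ (U, M) ∈ Qset n t c := by
  rw [mem_Qset_iff, mem_Qset_iff]
  change (U.1.image π).card = t ∧ cc ⟨U.1.image π, odd_card_image π U⟩ (π • M) = c ↔ U.1.card = t ∧ cc U M = c
  rw [card_image_of_injective _ π.injective, cc_perm]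

/-- **Multilevel weights are relabelling-invariant**: `W(π U, π·M) = W(U, M)` for `W = levelWeight n t C w`.
[cite: Rothvoss2017, §2 (PDF p. 6)] -/
theorem levelWeight_relabel (π : Equiv.Perm (Fin n)) (t : ℕ) (C : Finset ℕ) (w : ℕ → ℝ) (U : OddSet n)
    (M : PMatch n) :
    levelWeight n t C w ⟨U.1.image π, odd_card_image π U⟩ (π • M) = levelWeight n t C w U M := by
  unfold levelWeight
  refine sum_congr rfl fun c _ => ?_
  simp only [mem_Qset_relabel_iff]

/-! ### §2 Double sums are invariant under the diagonal relabelling -/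

/-- **Diagonal relabelling invariance of double sums** over (odd sets × perfect matchings). -/
theorem sum_sum_relabel (π : Equiv.Perm (Fin n)) (G : OddSet n → PMatch n → ℝ) :
    ∑ U : OddSet n, ∑ M : PMatch n, G ⟨U.1.image π, odd_card_image π U⟩ (π • M) = ∑ U, ∑ M, G U M := by
  -- the relabelling of odd sets is a bijection with inverse the relabelling by `π⁻¹`
  let eU : OddSet n ≃ OddSet n :=
    { toFun := fun U => ⟨U.1.image π, odd_card_image π U⟩
      invFun := fun U => ⟨U.1.image ⇑π⁻¹, odd_card_image π⁻¹ U⟩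
      left_inv := fun U => image_inv_image_oddSet π U
      right_inv := fun U => image_image_inv_oddSet π U }
  let eM : PMatch n ≃ PMatch n := MulAction.toPerm π
  calc ∑ U : OddSet n, ∑ M : PMatch n, G ⟨U.1.image π, odd_card_image π U⟩ (π • M)
      = ∑ U : OddSet n, ∑ M : PMatch n, G (eU U) (eM M) := rfl
    _ = ∑ U : OddSet n, ∑ M : PMatch n, G (eU U) M :=
        sum_congr rfl fun U _ => Equiv.sum_comp eM (fun M => G (eU U) M)
    _ = ∑ U, ∑ M, G U M := Equiv.sum_comp eU (fun U => ∑ M, G U M)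

/-! ### §3 Relabelled strategies -/

/-- **A relabelled psd rectangle is a psd rectangle**: `(X ∘ π, Y ∘ π)` — the tight pairs are permuted among themselves. -/
theorem isPsdRect_relabel (π : Equiv.Perm (Fin n)) {r : ℕ} {X : OddSet n → Matrix (Fin r) (Fin r) ℝ}
    {Y : PMatch n → Matrix (Fin r) (Fin r) ℝ} (h : IsPsdRect X Y) :
    IsPsdRect (fun U => X ⟨U.1.image π, odd_card_image π U⟩) (fun M => Y (π • M)) := by
  obtain ⟨hX, hY, hXY⟩ := h
  refine ⟨fun U => hX _, fun M => hY _, fun U M hcc => ?_⟩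
  exact hXY _ _ (by rw [cc_perm]; exact hcc)

/-- **The value is relabelling-invariant**: the relabelled strategy has the same value against every multilevel weight. -/
theorem value_relabel (π : Equiv.Perm (Fin n)) (t : ℕ) (C : Finset ℕ) (w : ℕ → ℝ) {r : ℕ}
    (X : OddSet n → Matrix (Fin r) (Fin r) ℝ) (Y : PMatch n → Matrix (Fin r) (Fin r) ℝ) :
    ∑ U, ∑ M, levelWeight n t C w U M * (X ⟨U.1.image π, odd_card_image π U⟩ * Y (π • M)).trace =
      ∑ U, ∑ M, levelWeight n t C w U M * (X U * Y M).trace := by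
  calc ∑ U, ∑ M, levelWeight n t C w U M * (X ⟨U.1.image π, odd_card_image π U⟩ * Y (π • M)).trace
      = ∑ U, ∑ M, levelWeight n t C w ⟨U.1.image π, odd_card_image π U⟩ (π • M) *
          (X ⟨U.1.image π, odd_card_image π U⟩ * Y (π • M)).trace := by
        refine sum_congr rfl fun U _ => sum_congr rfl fun M _ => ?_
        rw [levelWeight_relabel]
    _ = ∑ U, ∑ M, levelWeight n t C w U M * (X U * Y M).trace :=
        sum_sum_relabel π fun U M => levelWeight n t C w U M * (X U * Y M).trace

/-- The same with the general weight form: for ANY relabelling-invariant weight `W` the value is invariant. -/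
theorem value_relabel_of_invariant (π : Equiv.Perm (Fin n)) (W : OddSet n → PMatch n → ℝ)
    (hW : ∀ U M, W ⟨U.1.image π, odd_card_image π U⟩ (π • M) = W U M) {r : ℕ}
    (X : OddSet n → Matrix (Fin r) (Fin r) ℝ) (Y : PMatch n → Matrix (Fin r) (Fin r) ℝ) :
    ∑ U, ∑ M, W U M * (X ⟨U.1.image π, odd_card_image π U⟩ * Y (π • M)).trace =
      ∑ U, ∑ M, W U M * (X U * Y M).trace := by
  calc ∑ U, ∑ M, W U M * (X ⟨U.1.image π, odd_card_image π U⟩ * Y (π • M)).trace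
      = ∑ U, ∑ M, W ⟨U.1.image π, odd_card_image π U⟩ (π • M) *
          (X ⟨U.1.image π, odd_card_image π U⟩ * Y (π • M)).trace := by
        refine sum_congr rfl fun U _ => sum_congr rfl fun M _ => ?_
        rw [hW]
    _ = ∑ U, ∑ M, W U M * (X U * Y M).trace := sum_sum_relabel π fun U M => W U M * (X U * Y M).trace

/-- **Level profiles are relabelling-invariant**: the relabelled strategy has the same level profile. -/
theorem levelProfile_relabel (π : Equiv.Perm (Fin n)) (t : ℕ) {r : ℕ} (X : OddSet n → Matrix (Fin r) (Fin r) ℝ)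
    (Y : PMatch n → Matrix (Fin r) (Fin r) ℝ) (c : ℕ) :
    levelProfile n t r (fun U => X ⟨U.1.image π, odd_card_image π U⟩) (fun M => Y (π • M)) c =
      levelProfile n t r X Y c := by
  classical
  unfold levelProfile
  congr 1
  -- the numerator is a double sum of an indicator-weighted function
  have key : ∀ (F : OddSet n → PMatch n → ℝ),
      ∑ q ∈ Qset n t c, F q.1 q.2 = ∑ U, ∑ M, (if (U, M) ∈ Qset n t c then F U M else 0) :=
    fun F => (sum_sum_ite_mem (Qset n t c) F).symm
  rw [key (fun U M => (X ⟨U.1.image π, odd_card_image π U⟩ * Y (π • M)).trace), key (fun U M => (X U * Y M).trace)]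
  rw [← sum_sum_relabel π (fun U M => if (U, M) ∈ Qset n t c then (X U * Y M).trace else 0)]
  refine sum_congr rfl fun U _ => sum_congr rfl fun M _ => ?_
  simp only [mem_Qset_relabel_iff]

end Summit.PneNP.PneNP.Theorems.ChebyshevTracialDesignRelabelling

end
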